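import Summits.Ventures.PercRepro.S2ContractionLever
import Summits.Ventures.PercRepro.S2MaxExtensionPairs

/-!
# PercRepro — S2: THE CAPS OF THE CONTRACTION LEVER (p7, gen 14; sub-claim S2; the case `ν = 4` of `(14, 7)`)

Three counts the instance of the contraction lever needs: **`ncard_dep_two_le`** — the dependent `2`-sets of a loopless finite matroid of dual
rank `ν` number `≤ C(ν + 1, 2)` (each is a `2`-circuit; the kit's circuit count); **`ncard_four_eRk_le_two_eq_zero`** — no `4`-set has rank `≤ 2`
when two distinct points have rank `2` and lines have `≤ 3` points; **`ncard_dep_three_mul_three_le`** — the dependent `3`-subsets of a set `W`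
(its triangles) number `≤ C(|W|, 2)/3`: each has three `2`-subsets and a pair lies in at most one (two triangles through a pair would give `4`
points of rank `2`; `Finset.card_mul_le_card_mul`). At `(14, 7)`, `ν = 4`: `D₂(N) ≤ 6`, `R₄² = 0`, `D₃(W) ≤ 12`. Axioms: standard.
-/

open scoped Matroid

namespace PercRepro

namespace S2

open Set

variable {α : Type}

/-- **The dependent `2`-sets of a loopless matroid** with `N✶.eRank = ν`: at most `C(ν + 1, 2)`. -/
theorem ncard_dep_two_le (N : Matroid α) [N.Finite] {ν : ℕ} (hν : N✶.eRank = (ν : ℕ∞))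
    (hL : ∀ e ∈ N.E, ¬ N.IsLoop e) :
    {X : Set α | X ⊆ N.E ∧ X.ncard = 2 ∧ N.Dep X}.ncard ≤ (ν + 1).choose 2 := by
  have hsub : {X : Set α | X ⊆ N.E ∧ X.ncard = 2 ∧ N.Dep X} ⊆ {C : Set α | N.IsCircuit C ∧ C.ncard = 2} := by
    rintro X ⟨hXE, hX2, hXdep⟩
    have hXfin : X.Finite := N.ground_finite.subset hXE
    obtain ⟨C, hCX, hC⟩ := hXdep.exists_isCircuit_subset
    have hCfin : C.Finite := hXfin.subset hCX
    have hC2 : C.ncard ≤ 2 := by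
      have := Set.ncard_le_ncard hCX hXfin
      omega
    have hC1 : C.ncard ≠ 1 := by
      intro h1
      obtain ⟨e, rfl⟩ := Set.ncard_eq_one.1 h1
      exact hL e (hC.subset_ground (Set.mem_singleton e)) (Matroid.singleton_isCircuit.1 hC)
    have hC0 : C.ncard ≠ 0 := by
      intro h0
      rw [Set.ncard_eq_zero hCfin] at h0
      exact hC.nonempty.ne_empty h0
    have hCeq : C = X := Set.eq_of_subset_of_ncard_le hCX (by omega) hXfin
    exact ⟨hCeq ▸ hC, hX2⟩
  have h := Matroid.ncard_circuits_le_choose N hν 1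
  norm_num at h
  exact (Set.ncard_le_ncard hsub (N.ground_finite.finite_subsets.subset (fun C hC => hC.1.subset_ground))).trans h

/-- **No `4`-set of rank `≤ 2`** when two distinct points have rank `2` and lines have `≤ 3` points. -/
theorem ncard_four_eRk_le_two_eq_zero (M : Matroid α) [M.Finite]
    (hs : ∀ e ∈ M.E, ∀ f ∈ M.E, e ≠ f → M.eRk {e, f} = 2)
    (hC1 : ∀ L ⊆ M.E, M.eRk L = 2 → L.ncard ≤ 3) {W : Set α} (hW : W ⊆ M.E) :
    {T : Set α | T ⊆ W ∧ T.ncard = 4 ∧ M.eRk T ≤ 2}.ncard = 0 := by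
  rw [Set.ncard_eq_zero (M.ground_finite.finite_subsets.subset (fun T hT => hT.1.trans hW))]
  rw [Set.eq_empty_iff_forall_notMem]
  rintro T ⟨hTW, hT4, hTr⟩
  have hTE : T ⊆ M.E := hTW.trans hW
  have hTfin : T.Finite := M.ground_finite.subset hTE
  obtain ⟨x, y, hxy, hx, hy⟩ : ∃ x y, x ≠ y ∧ x ∈ T ∧ y ∈ T := by
    obtain ⟨x, y, hxy, hx, hy⟩ := (Set.one_lt_ncard_iff hTfin).1 (by omega)
    exact ⟨x, y, hy, hxy, hx⟩
  have h2 : M.eRk {x, y} = 2 := hs x (hTE hx) y (hTE hy) hxy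
  have hle : (2 : ℕ∞) ≤ M.eRk T := h2 ▸ M.eRk_mono (Set.pair_subset hx hy)
  have hTr2 : M.eRk T = 2 := le_antisymm hTr hle
  have := hC1 T hTE hTr2
  omega

/-- A dependent `3`-set `T` with two distinct points `x ≠ y` of rank `2` lies in `cl {x, y}`. -/
theorem subset_closure_pair_of_dep_three (M : Matroid α) [M.Finite]
    (hs : ∀ e ∈ M.E, ∀ f ∈ M.E, e ≠ f → M.eRk {e, f} = 2)
    {T : Set α} (hTE : T ⊆ M.E) (hT3 : T.ncard = 3) (hTdep : M.Dep T) {x y : α} (hx : x ∈ T) (hy : y ∈ T)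
    (hxy : x ≠ y) : T ⊆ M.closure {x, y} := by
  have hTfin : T.Finite := M.ground_finite.subset hTE
  have h2 : M.eRk {x, y} = 2 := hs x (hTE hx) y (hTE hy) hxy
  have hlt : M.eRk T < 3 := by
    have := M.eRk_lt_encard_of_dep_of_finite hTfin hTdep
    rwa [← hTfin.cast_ncard_eq, hT3] at this
  have hTr : M.eRk T ≤ 2 := by
    have h : M.eRk T < (2 : ℕ∞) + 1 := by
      rw [show (2 : ℕ∞) + 1 = 3 by norm_num]
      exact hlt
    exact Order.le_of_lt_add_one h
  have hcl := (M.isRkFinite_set {x, y}).closure_eq_closure_of_subset_of_eRk_ge_eRk (Set.pair_subset hx hy)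
    (by rw [h2]; exact hTr)
  rw [hcl]
  exact M.subset_closure T hTE

open scoped Classical in
/-- **The triangles inside `W`, double counted by their pairs**: `3·#{dependent 3-subsets of W} ≤ C(|W|, 2)`. -/
theorem ncard_dep_three_mul_three_le (M : Matroid α) [M.Finite]
    (hs : ∀ e ∈ M.E, ∀ f ∈ M.E, e ≠ f → M.eRk {e, f} = 2)
    (hC1 : ∀ L ⊆ M.E, M.eRk L = 2 → L.ncard ≤ 3) {W : Set α} (hW : W ⊆ M.E) :
    {T : Set α | T ⊆ W ∧ T.ncard = 3 ∧ M.Dep T}.ncard * 3 ≤ W.ncard.choose 2 := by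
  have hWfin : W.Finite := M.ground_finite.subset hW
  set Wf : Finset α := hWfin.toFinset with hWf
  have hWfc : (Wf : Set α) = W := Set.Finite.coe_toFinset _
  set s : Finset (Set α) := (Matroid.subsF Wf 3).filter (fun T => M.Dep T) with hsdef
  set t : Finset (Set α) := Matroid.subsF Wf 2 with htdef
  have hmem_s : ∀ T, T ∈ s ↔ T ⊆ W ∧ T.ncard = 3 ∧ M.Dep T := by
    intro T
    rw [hsdef, Finset.mem_filter, mem_subsF_iff, hWfc]
    tauto
  have hcard_s : {T : Set α | T ⊆ W ∧ T.ncard = 3 ∧ M.Dep T}.ncard = s.card := by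
    rw [← Set.ncard_coe_finset s]
    congr 1
    ext T
    rw [Finset.mem_coe, hmem_s]
    rfl
  have hcard_t : t.card ≤ W.ncard.choose 2 := by
    have h := Matroid.card_subsF_le Wf 2
    rw [hWf, ← Set.ncard_eq_toFinset_card W hWfin] at h
    exact h
  rw [hcard_s]
  refine le_trans (Finset.card_mul_le_card_mul (fun (T : Set α) (P : Set α) => P ⊆ T) ?_ ?_) (by rw [mul_one]; exact hcard_t)
  · -- each triangle has three pairs below it
    intro T hT
    obtain ⟨hTW, hT3, -⟩ := (hmem_s T).1 hT
    obtain ⟨a, b, c, hab, hac, hbc, rfl⟩ := Set.ncard_eq_three.1 hT3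
    have hpair : ∀ {u v : α}, u ∈ ({a, b, c} : Set α) → v ∈ ({a, b, c} : Set α) → u ≠ v →
        ({u, v} : Set α) ∈ t.bipartiteAbove (fun (T : Set α) (P : Set α) => P ⊆ T) {a, b, c} := by
      intro u v hu hv huv
      rw [Finset.mem_bipartiteAbove]
      refine ⟨Matroid.mem_subsF_of (by rw [hWfc]; exact (Set.pair_subset hu hv).trans hTW) (Set.ncard_pair huv),
        Set.pair_subset hu hv⟩
    have h1 := hpair (Set.mem_insert a _) (Set.mem_insert_of_mem a (Set.mem_insert b _)) hab
    have h2 := hpair (Set.mem_insert a _) (Set.mem_insert_of_mem a (Set.mem_insert_of_mem b rfl)) hac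
    have h3 := hpair (Set.mem_insert_of_mem a (Set.mem_insert b _)) (Set.mem_insert_of_mem a (Set.mem_insert_of_mem b rfl)) hbc
    have hne12 : ({a, b} : Set α) ≠ {a, c} := fun h => hbc (by
      have : b ∈ ({a, c} : Set α) := h ▸ Set.mem_insert_of_mem a rfl
      rcases this with h' | h'
      · exact absurd h' hab.symm
      · exact h')
    have hne13 : ({a, b} : Set α) ≠ {b, c} := fun h => hac (by
      have : a ∈ ({b, c} : Set α) := h ▸ Set.mem_insert a _
      rcases this with h' | h'
      · exact absurd h' hab
      · exact h')
    have hne23 : ({a, c} : Set α) ≠ {b, c} := fun h => hab (by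
      have : a ∈ ({b, c} : Set α) := h ▸ Set.mem_insert a _
      rcases this with h' | h'
      · exact h'
      · exact absurd h' hac)
    calc 3 = ({({a, b} : Set α), {a, c}, {b, c}} : Finset (Set α)).card := by
          rw [Finset.card_insert_of_notMem, Finset.card_pair hne23]
          simp only [Finset.mem_insert, Finset.mem_singleton, not_or]
          exact ⟨hne12, hne13⟩
      _ ≤ _ := Finset.card_le_card (by
          intro P hP
          simp only [Finset.mem_insert, Finset.mem_singleton] at hP
          rcases hP with rfl | rfl | rfl
          · exact h1
          · exact h2
          · exact h3)
  · -- a pair lies in at most one triangle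
    intro P hP
    obtain ⟨hPW, hP2⟩ := mem_subsF_iff.1 hP
    rw [hWfc] at hPW
    obtain ⟨x, y, hxy, rfl⟩ := Set.ncard_eq_two.1 hP2
    rw [Finset.card_le_one]
    intro T₁ hT₁ T₂ hT₂
    rw [Finset.mem_bipartiteBelow] at hT₁ hT₂
    obtain ⟨hT₁s, hPT₁⟩ := hT₁
    obtain ⟨hT₂s, hPT₂⟩ := hT₂
    obtain ⟨hT₁W, hT₁3, hT₁dep⟩ := (hmem_s T₁).1 hT₁s
    obtain ⟨hT₂W, hT₂3, hT₂dep⟩ := (hmem_s T₂).1 hT₂s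
    have hx₁ : x ∈ T₁ := hPT₁ (Set.mem_insert x _)
    have hy₁ : y ∈ T₁ := hPT₁ (Set.mem_insert_of_mem x rfl)
    have hx₂ : x ∈ T₂ := hPT₂ (Set.mem_insert x _)
    have hy₂ : y ∈ T₂ := hPT₂ (Set.mem_insert_of_mem x rfl)
    have hc₁ := subset_closure_pair_of_dep_three M hs (hT₁W.trans hW) hT₁3 hT₁dep hx₁ hy₁ hxy
    have hc₂ := subset_closure_pair_of_dep_three M hs (hT₂W.trans hW) hT₂3 hT₂dep hx₂ hy₂ hxy
    -- `T₁ ∪ T₂ ⊆ cl {x, y}` has rank `2`, hence `≤ 3` points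
    have hxE : x ∈ M.E := hW (hPW (Set.mem_insert x _))
    have hyE : y ∈ M.E := hW (hPW (Set.mem_insert_of_mem x rfl))
    have hUcl : T₁ ∪ T₂ ⊆ M.closure {x, y} := Set.union_subset hc₁ hc₂
    have hUE : T₁ ∪ T₂ ⊆ M.E := hUcl.trans (M.closure_subset_ground _)
    have hUr : M.eRk (T₁ ∪ T₂) = 2 := by
      refine le_antisymm ?_ ?_
      · calc M.eRk (T₁ ∪ T₂) ≤ M.eRk (M.closure {x, y}) := M.eRk_mono hUcl
          _ = M.eRk {x, y} := M.eRk_closure_eq _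
          _ = 2 := hs x hxE y hyE hxy
      · calc (2 : ℕ∞) = M.eRk {x, y} := (hs x hxE y hyE hxy).symm
          _ ≤ M.eRk (T₁ ∪ T₂) := M.eRk_mono ((Set.pair_subset hx₁ hy₁).trans Set.subset_union_left)
    have h3 := hC1 (T₁ ∪ T₂) hUE hUr
    have hT₁fin : T₁.Finite := M.ground_finite.subset (hT₁W.trans hW)
    have hT₂fin : T₂.Finite := M.ground_finite.subset (hT₂W.trans hW)
    have hu := Set.ncard_union_add_ncard_inter T₁ T₂ hT₁fin hT₂fin
    have hi : (T₁ ∩ T₂).ncard ≤ T₁.ncard := Set.ncard_le_ncard Set.inter_subset_left hT₁fin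
    have hT₁eq : T₁ ∩ T₂ = T₁ := Set.eq_of_subset_of_ncard_le Set.inter_subset_left (by omega) hT₁fin
    have hsub : T₁ ⊆ T₂ := by rw [← hT₁eq]; exact Set.inter_subset_right
    exact Set.eq_of_subset_of_ncard_le hsub (by omega) hT₂fin

end S2

end PercRepro
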